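import Mathlib

/-!
# Crux `IntegralOrbits.IntDetQP` (stmt-ValiantsHypothesis-7677), line `birth` —
# stub `stub_shortWordBasis` (L1): the words of length `≤ m²` contain a basis

Let `M : ι → A` be a tuple in an algebra `A` over a field `K` (for the crux `A = M_m(ℂ)`,
`K = ℂ`) and write `f w = (w.map M).prod` for the product of a word `w : List ι` (`f [] = 1`).
Put `V ℓ = span_K {f w | |w| ≤ ℓ}` (the *word filtration*).  Then

* `V` is monotone and `x ∈ V ℓ ⇒ M v * x ∈ V (ℓ+1)` (left multiplication is linear and sends
  the generator `f w` to the generator `f (v :: w)`);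
* hence `V (ℓ+1) = V ℓ ⇒ V (ℓ+2) = V (ℓ+1)` (a word of length `≤ ℓ+2` is `[]` or `v :: w` with
  `|w| ≤ ℓ+1`), so the filtration is stationary from its first non-strict step on, and if all
  words span `A` the stationary value is `⊤`;
* counting dimensions, `V ℓ = ⊤` or `dim V ℓ ≥ ℓ + 1`; at `ℓ = dim A` the second alternative is
  impossible, so `V (dim A) = ⊤`.

For `A = M_m(ℂ)` (`dim A = m·m`) a linearly independent spanning subfamily of the words of
length `≤ m·m` (`exists_linearIndependent'`) has `m·m` members; we index it by `Fin m × Fin m`.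

References: folklore (the standard "lengths `≤ dim A` suffice" filtration argument for the
words generating a finite-dimensional algebra).
-/

set_option linter.dupNamespace false -- single-conjunct summit

namespace Summit.ValiantsHypothesis.ValiantsHypothesis.Theorems

namespace IntegralOrbitsIntDetQPShortWordBasis

open Submodule

variable {K A ι : Type*} [Field K] [Ring A] [Algebra K A] {M : ι → A} {V : ℕ → Submodule K A}

/-- The word filtration `V ℓ = span {f w | |w| ≤ ℓ}` is monotone. [folklore] -/
theorem filt_mono
    (hV : ∀ ℓ, V ℓ = span K ((fun w : List ι => (w.map M).prod) '' {w | w.length ≤ ℓ}))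
    {ℓ ℓ' : ℕ} (h : ℓ ≤ ℓ') : V ℓ ≤ V ℓ' := by
  rw [hV, hV]
  exact span_mono (Set.image_mono fun w (hw : w.length ≤ ℓ) => hw.trans h)

/-- The product of a word lies in the filtration step of its length. [folklore] -/
theorem prod_mem_filt
    (hV : ∀ ℓ, V ℓ = span K ((fun w : List ι => (w.map M).prod) '' {w | w.length ≤ ℓ}))
    (w : List ι) : (w.map M).prod ∈ V w.length := by
  rw [hV]
  exact subset_span ⟨w, Set.mem_setOf.mpr le_rfl, rfl⟩

/-- Left multiplication by a letter raises the filtration degree by at most one. [folklore] -/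
theorem mul_mem_filt_succ
    (hV : ∀ ℓ, V ℓ = span K ((fun w : List ι => (w.map M).prod) '' {w | w.length ≤ ℓ}))
    (v : ι) {ℓ : ℕ} {x : A} (hx : x ∈ V ℓ) : M v * x ∈ V (ℓ + 1) := by
  rw [hV] at hx ⊢
  induction hx using Submodule.span_induction with
  | mem x hx =>
    obtain ⟨w, hw, rfl⟩ := hx
    exact subset_span ⟨v :: w, Nat.succ_le_succ hw, by simp⟩
  | zero => rw [mul_zero]; exact zero_mem _
  | add x y _ _ hx hy => rw [mul_add]; exact add_mem hx hy
  | smul c x _ hx => rw [mul_smul_comm]; exact smul_mem _ c hx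

/-- One non-strict step makes the next step non-strict. [folklore] -/
theorem filt_succ_succ
    (hV : ∀ ℓ, V ℓ = span K ((fun w : List ι => (w.map M).prod) '' {w | w.length ≤ ℓ}))
    {ℓ : ℕ} (h : V (ℓ + 1) = V ℓ) : V (ℓ + 1 + 1) = V (ℓ + 1) := by
  refine le_antisymm ?_ (filt_mono hV (Nat.le_succ _))
  rw [hV (ℓ + 1 + 1)]
  refine span_le.mpr ?_
  rintro _ ⟨w, hw, rfl⟩
  cases w with
  | nil => exact filt_mono hV (Nat.zero_le _) (prod_mem_filt hV [])
  | cons v w =>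
    have hw' : w.length ≤ ℓ + 1 := by simpa using hw
    have hx : (w.map M).prod ∈ V ℓ := by
      rw [← h]
      exact filt_mono hV hw' (prod_mem_filt hV w)
    simpa using mul_mem_filt_succ hV v hx

/-- After one non-strict step the filtration is stationary. [folklore] -/
theorem filt_stable
    (hV : ∀ ℓ, V ℓ = span K ((fun w : List ι => (w.map M).prod) '' {w | w.length ≤ ℓ}))
    {ℓ : ℕ} (h : V (ℓ + 1) = V ℓ) : ∀ k, V (ℓ + k) = V ℓ := by
  have hstep : ∀ k, V (ℓ + k + 1) = V (ℓ + k) := by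
    intro k
    induction k with
    | zero => exact h
    | succ k ih => exact filt_succ_succ hV ih
  intro k
  induction k with
  | zero => rfl
  | succ k ih => rw [← Nat.add_assoc, hstep, ih]

/-- If all words span, the stationary value of the filtration is `⊤`. [folklore] -/
theorem filt_eq_top_of_eq
    (hV : ∀ ℓ, V ℓ = span K ((fun w : List ι => (w.map M).prod) '' {w | w.length ≤ ℓ}))
    (htop : span K (Set.range fun w : List ι => (w.map M).prod) = ⊤)
    {ℓ : ℕ} (h : V (ℓ + 1) = V ℓ) : V ℓ = ⊤ := by
  refine eq_top_iff.mpr ?_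
  rw [← htop]
  refine span_le.mpr ?_
  rintro _ ⟨w, rfl⟩
  have hw := filt_mono hV (Nat.le_add_left w.length ℓ) (prod_mem_filt hV w)
  rwa [filt_stable hV h] at hw

/-- Dimension count: `V ℓ = ⊤` or `dim V ℓ ≥ ℓ + 1`. [folklore] -/
theorem filt_top_or_le_finrank [FiniteDimensional K A]
    (hV : ∀ ℓ, V ℓ = span K ((fun w : List ι => (w.map M).prod) '' {w | w.length ≤ ℓ}))
    (htop : span K (Set.range fun w : List ι => (w.map M).prod) = ⊤) (ℓ : ℕ) :
    V ℓ = ⊤ ∨ ℓ + 1 ≤ Module.finrank K (V ℓ) := by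
  induction ℓ with
  | zero =>
    rcases subsingleton_or_nontrivial A with hA | hA
    · exact Or.inl (eq_top_iff.mpr fun x _ => by rw [Subsingleton.elim x 0]; exact zero_mem _)
    · refine Or.inr (Submodule.one_le_finrank_iff.mpr ?_)
      have h1 : (1 : A) ∈ V 0 := by simpa using prod_mem_filt hV []
      exact (Submodule.ne_bot_iff _).mpr ⟨1, h1, one_ne_zero⟩
  | succ ℓ ih =>
    rcases ih with h | h
    · refine Or.inl (eq_top_iff.mpr ?_)
      rw [← h]
      exact filt_mono hV (Nat.le_succ ℓ)
    · by_cases he : V (ℓ + 1) = V ℓ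
      · exact Or.inl (he.trans (filt_eq_top_of_eq hV htop he))
      · refine Or.inr ?_
        have hlt : V ℓ < V (ℓ + 1) := lt_of_le_of_ne (filt_mono hV (Nat.le_succ ℓ)) (Ne.symm he)
        have := Submodule.finrank_lt_finrank_of_lt hlt
        omega

/-- The words of length `≤ dim A` already span. [folklore] -/
theorem filt_finrank_eq_top [FiniteDimensional K A]
    (hV : ∀ ℓ, V ℓ = span K ((fun w : List ι => (w.map M).prod) '' {w | w.length ≤ ℓ}))
    (htop : span K (Set.range fun w : List ι => (w.map M).prod) = ⊤) :
    V (Module.finrank K A) = ⊤ := by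
  refine (filt_top_or_le_finrank hV htop _).resolve_right fun h => ?_
  have := Submodule.finrank_le (V (Module.finrank K A))
  omega

end IntegralOrbitsIntDetQPShortWordBasis

open IntegralOrbitsIntDetQPShortWordBasis in
/-- **L1 — short word basis.** If the products of all words in a tuple
`M : ι → M_m(ℂ)` span `M_m(ℂ)`, then `m²` words of length `≤ m·m` have linearly independent
products (hence form a basis): the word filtration reaches `⊤` at step `dim M_m(ℂ) = m·m`, and a
linearly independent spanning subfamily of the short words has `m·m` members. [folklore] -/
theorem stub_shortWordBasis :
    ∀ (ι : Type) [Fintype ι] [DecidableEq ι] (m : ℕ) (M : ι → Matrix (Fin m) (Fin m) ℂ),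
      Submodule.span ℂ (Set.range fun w : List ι => (w.map M).prod) = ⊤ →
      ∃ b : Fin m × Fin m → List ι,
        (∀ i, (b i).length ≤ m * m) ∧ LinearIndependent ℂ (fun i => ((b i).map M).prod) := by
  intro ι _ _ m M htop
  obtain ⟨V, hV⟩ : ∃ V : ℕ → Submodule ℂ (Matrix (Fin m) (Fin m) ℂ), ∀ ℓ,
      V ℓ = Submodule.span ℂ ((fun w : List ι => (w.map M).prod) '' {w | w.length ≤ ℓ}) :=
    ⟨_, fun _ => rfl⟩
  have hdim : Module.finrank ℂ (Matrix (Fin m) (Fin m) ℂ) = m * m := by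
    simp [Module.finrank_matrix]
  have hVtop : V (m * m) = ⊤ := by
    have h := filt_finrank_eq_top hV htop
    rwa [hdim] at h
  set v : {w : List ι | w.length ≤ m * m} → Matrix (Fin m) (Fin m) ℂ :=
    fun w => (w.1.map M).prod
  have hvspan : Submodule.span ℂ (Set.range v) = ⊤ := by
    rw [← hVtop, hV, Set.image_eq_range]
  obtain ⟨κ, a, -, hspan, hli⟩ := exists_linearIndependent' ℂ v
  haveI : Finite κ := hli.finite
  letI : Fintype κ := Fintype.ofFinite κ
  have hcard : Fintype.card (Fin m × Fin m) = Fintype.card κ := by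
    rw [← finrank_span_eq_card hli, hspan, hvspan, finrank_top, hdim]
    simp
  let e := Fintype.equivOfCardEq hcard
  exact ⟨fun i => (a (e i)).1, fun i => (a (e i)).2, hli.comp e e.injective⟩

end Summit.ValiantsHypothesis.ValiantsHypothesis.Theorems
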